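import Literature.NumberTheory.Automorphic.UnitaryGroupRankOneCartanAnyInvolution   -- ★ setting `U(σ, Φ₃)(K)`, `glInt`, `coe_pow_eq_diagonal`
import Literature.NumberTheory.Automorphic.LocalUnitaryGroupCenter                -- ★ `exists_coe_eq_scalar_of_mem_center_unitaryGroupOfForm`
import Literature.NumberTheory.Automorphic.ValuedFieldValuativeRelBridge            -- ★ `mem_glInt_iff_forall_v_le_one`
import Literature.NumberTheory.Automorphic.SquareIntegrableRayCoefficientDecay      -- ★ `RayCoefficient.pairwise_disjoint_image_doubleCoset_of_height`
import HarnessLib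

/-!
# The max-entry valuation height `h(g) = max_{i,j} |g_{ij}|`: bi-`GL_n(𝒪)`-invariance, invariance under norm-one scalars, its value on a
# diagonal ray, and the DISJOINTNESS of the Cartan shells `K aᵐ K · Z ∕ Z` of `U(σ, Φ₃)(K)` (Bruhat–Tits 1972, (4.4.3); Cartier 1979, §IV.1)

Topic `NumberTheory/Automorphic`; namespace `Literature.NumberTheory.Automorphic.EntryHeight`.  THEOREMS ONLY; no definition (the height is
the explicit term `Finset.univ.sup fun p : Fin n × Fin n ↦ Valued.v (M p.1 p.2)`), no named fact, no instance, no notation, no `sorry`.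
Cell `hodgecm-mathlib`, F0∕P3, road N5 (#109 `UnitaryGroup.U3SquareIntegrableExponents` [Casselman1995, Thm. 4.4.6]), file R5c: the
«disjointness by a height» input of the ⇒ half (★ `RayCoefficient.norm_sq_mul_lt_one`'s binder `hdisj`, fed through ★
`RayCoefficient.pairwise_disjoint_image_doubleCoset_of_height`).

## The argument
Over a valued field `(K, |·|)` the function `h(M) = max_{i,j} |M_{ij}|` on `n × n` matrices satisfies `h(k M) ≤ h(M)` and `h(M k) ≤ h(M)`
whenever all entries of `k` have `|k_{ij}| ≤ 1` (ultrametric inequality), hence `h(k M) = h(M) = h(M k)` for `k ∈ GL_n(𝒪)` (apply the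
inequality to `k` and to `k⁻¹`); `h(M · u1) = h(M)` for a scalar `u` with `|u| = 1`; and `h(diag(d)) = max_i |d_i|`.  This is the
elementary-divisor invariant «largest entry» by which the Cartan double cosets `GL_n(𝒪) · diag · GL_n(𝒪)` are told apart
([BruhatTits1972, (4.4.3)]; [CartierCorvallis1979, §IV.1]; for `GL_n`: [Macdonald1971, Ch. V §2]).  On the unitary group
`U = U(σ, Φ₃)(K)` (`σ` an involution with `|σ x| = |x|`, `2, 3 ≠ 0` in `K`) every central element is a scalar `u · 1` (★
`exists_coe_eq_scalar_of_mem_center_unitaryGroupOfForm`) with `σ(u) u = 1`, so `|u| = 1` and `h` is `Z(U)`-invariant; along the ray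
`a = d(ϖ, 1, (σϖ)⁻¹)` (★ `coe_pow_eq_diagonal`) `h(aᵐ) = |ϖ|⁻ᵐ` is injective in `m` for `0 < |ϖ| < 1`.  Consequently, for EVERY subgroup
`K' ≤ K₀ = U ∩ GL₃(𝒪)`, the shells `(K' aᵐ K') Z(U) ∕ Z(U) ⊆ U ∕ Z(U)` are pairwise disjoint.

## What is formalised
* §1 (any valued field, any `n`) `v_apply_le_sup`, `sup_v_le_iff`, `sup_v_mul_le_of_forall_v_le_one` ∕ `…'` (left ∕ right),
  `sup_v_coe_mul_eq` ∕ `sup_v_mul_coe_eq` (bi-invariance under `k ∈ GL_n` with `k, k⁻¹` integral), `sup_v_mul_smul_one_eq` (norm-one scalars),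
  `sup_v_diagonal`.
* §2 (`Valued K ℤᵐ⁰` compatible with a `ValuativeRel`, `GL_n(𝒪) = glInt n K`) `sup_v_coe_mul_eq_of_mem_glInt` ∕ `sup_v_mul_coe_eq_of_mem_glInt`.
* §3 (`U = U(σ, Φ₃)(K)`) `v_eq_one_of_coe_eq_scalar` (scalars in `U` have norm-one parameter), `sup_v_mul_coe_eq_of_mem_center`,
  `sup_v_coe_pow_eq` (`h(aᵐ) = |ϖ|⁻¹ ^ m`), and the consumer head **`pairwise_disjoint_image_doubleCoset_pow`**.

## References
* [BruhatTits1972] F. Bruhat, J. Tits, *Groupes réductifs sur un corps local I*, Publ. Math. IHÉS 41 (1972), (4.4.3)–(4.4.4) (Cartan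
  decomposition `G = K A⁺ K`, disjointness of the double cosets).
* [CartierCorvallis1979] P. Cartier, *Representations of `p`-adic groups: a survey*, Proc. Sympos. Pure Math. 33.1 (1979), §IV.1.
* [Macdonald1971] I. G. Macdonald, *Spherical functions on a group of `p`-adic type*, Madras (1971), Ch. V §2 (elementary divisors for `GL_n`).
* [Casselman1995] W. Casselman, *Introduction to the theory of admissible representations of `p`-adic reductive groups* (1995 notes),
  Thm. 4.4.6 (the consumer).
-/

set_option autoImplicit false

open scoped MatrixGroups Pointwise WithZero
open Matrix

namespace Literature.NumberTheory.Automorphic.EntryHeight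

/-! ## §1 The height over a valued field: ultrametric bounds, bi-invariance, scalars, diagonal matrices -/

section Generic

variable {K : Type*} [Field K] {Γ₀ : Type*} [LinearOrderedCommGroupWithZero Γ₀] [Valued K Γ₀] {n : ℕ}

/-- Every entry is bounded by the height: `|M_{ij}| ≤ h(M)`. [cite: CartierCorvallis1979, §IV.1] -/
theorem v_apply_le_sup (M : Matrix (Fin n) (Fin n) K) (i j : Fin n) :
    Valued.v (M i j) ≤ Finset.univ.sup fun p : Fin n × Fin n => Valued.v (M p.1 p.2) :=
  Finset.le_sup (f := fun p : Fin n × Fin n => Valued.v (M p.1 p.2)) (Finset.mem_univ (i, j))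

/-- `h(M) ≤ b ↔ ∀ i j, |M_{ij}| ≤ b`. [cite: CartierCorvallis1979, §IV.1] -/
theorem sup_v_le_iff (M : Matrix (Fin n) (Fin n) K) (b : Γ₀) :
    (Finset.univ.sup fun p : Fin n × Fin n => Valued.v (M p.1 p.2)) ≤ b ↔ ∀ i j, Valued.v (M i j) ≤ b := by
  rw [Finset.sup_le_iff]
  exact ⟨fun h i j => h (i, j) (Finset.mem_univ _), fun h p _ => h p.1 p.2⟩

/-- **Ultrametric bound, left**: if all entries of `k` have `|k_{ij}| ≤ 1` then `h(k M) ≤ h(M)`. [cite: CartierCorvallis1979, §IV.1] -/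
theorem sup_v_mul_le_of_forall_v_le_one {k : Matrix (Fin n) (Fin n) K} (hk : ∀ i j, Valued.v (k i j) ≤ 1)
    (M : Matrix (Fin n) (Fin n) K) :
    (Finset.univ.sup fun p : Fin n × Fin n => Valued.v ((k * M) p.1 p.2)) ≤
      Finset.univ.sup fun p : Fin n × Fin n => Valued.v (M p.1 p.2) := by
  rw [sup_v_le_iff]
  intro i j
  rw [Matrix.mul_apply]
  refine Valued.v.map_sum_le fun l _ => ?_
  rw [map_mul]
  calc Valued.v (k i l) * Valued.v (M l j)
      ≤ 1 * Finset.univ.sup fun p : Fin n × Fin n => Valued.v (M p.1 p.2) := mul_le_mul' (hk i l) (v_apply_le_sup M l j)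
    _ = _ := one_mul _

/-- **Ultrametric bound, right**: if all entries of `k` have `|k_{ij}| ≤ 1` then `h(M k) ≤ h(M)`. [cite: CartierCorvallis1979, §IV.1] -/
theorem sup_v_mul_le_of_forall_v_le_one' {k : Matrix (Fin n) (Fin n) K} (hk : ∀ i j, Valued.v (k i j) ≤ 1)
    (M : Matrix (Fin n) (Fin n) K) :
    (Finset.univ.sup fun p : Fin n × Fin n => Valued.v ((M * k) p.1 p.2)) ≤
      Finset.univ.sup fun p : Fin n × Fin n => Valued.v (M p.1 p.2) := by
  rw [sup_v_le_iff]
  intro i j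
  rw [Matrix.mul_apply]
  refine Valued.v.map_sum_le fun l _ => ?_
  rw [map_mul]
  calc Valued.v (M i l) * Valued.v (k l j)
      ≤ (Finset.univ.sup fun p : Fin n × Fin n => Valued.v (M p.1 p.2)) * 1 := mul_le_mul' (v_apply_le_sup M i l) (hk l j)
    _ = _ := mul_one _

/-- **Left invariance under integral invertible matrices**: if `k ∈ GL_n(K)` and `k, k⁻¹` have entries of norm `≤ 1` (`k ∈ GL_n(𝒪)`) then
`h(k M) = h(M)`. [cite: BruhatTits1972, (4.4.3)] [cite: CartierCorvallis1979, §IV.1] -/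
theorem sup_v_coe_mul_eq (k : GL (Fin n) K) (hk : ∀ i j, Valued.v ((k : Matrix (Fin n) (Fin n) K) i j) ≤ 1)
    (hk' : ∀ i j, Valued.v (((k⁻¹ : GL (Fin n) K) : Matrix (Fin n) (Fin n) K) i j) ≤ 1) (M : Matrix (Fin n) (Fin n) K) :
    (Finset.univ.sup fun p : Fin n × Fin n => Valued.v (((k : Matrix (Fin n) (Fin n) K) * M) p.1 p.2)) =
      Finset.univ.sup fun p : Fin n × Fin n => Valued.v (M p.1 p.2) := by
  refine le_antisymm (sup_v_mul_le_of_forall_v_le_one hk M) ?_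
  have hM : M = ((k⁻¹ : GL (Fin n) K) : Matrix (Fin n) (Fin n) K) * ((k : Matrix (Fin n) (Fin n) K) * M) := by
    rw [← Matrix.mul_assoc, ← Units.val_mul, inv_mul_cancel, Units.val_one, Matrix.one_mul]
  conv_lhs => rw [hM]
  exact sup_v_mul_le_of_forall_v_le_one hk' _

/-- **Right invariance under integral invertible matrices**: `h(M k) = h(M)` for `k ∈ GL_n(𝒪)`. [cite: BruhatTits1972, (4.4.3)] [cite: CartierCorvallis1979, §IV.1] -/
theorem sup_v_mul_coe_eq (k : GL (Fin n) K) (hk : ∀ i j, Valued.v ((k : Matrix (Fin n) (Fin n) K) i j) ≤ 1)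
    (hk' : ∀ i j, Valued.v (((k⁻¹ : GL (Fin n) K) : Matrix (Fin n) (Fin n) K) i j) ≤ 1) (M : Matrix (Fin n) (Fin n) K) :
    (Finset.univ.sup fun p : Fin n × Fin n => Valued.v ((M * (k : Matrix (Fin n) (Fin n) K)) p.1 p.2)) =
      Finset.univ.sup fun p : Fin n × Fin n => Valued.v (M p.1 p.2) := by
  refine le_antisymm (sup_v_mul_le_of_forall_v_le_one' hk M) ?_
  have hM : M = M * (k : Matrix (Fin n) (Fin n) K) * ((k⁻¹ : GL (Fin n) K) : Matrix (Fin n) (Fin n) K) := by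
    rw [Matrix.mul_assoc, ← Units.val_mul, mul_inv_cancel, Units.val_one, Matrix.mul_one]
  conv_lhs => rw [hM]
  exact sup_v_mul_le_of_forall_v_le_one' hk' _

/-- **Invariance under norm-one scalars**: `h(M · (u 1)) = h(M)` for `|u| = 1`. [cite: CartierCorvallis1979, §IV.1] -/
theorem sup_v_mul_smul_one_eq {u : K} (hu : Valued.v u = 1) (M : Matrix (Fin n) (Fin n) K) :
    (Finset.univ.sup fun p : Fin n × Fin n => Valued.v ((M * (u • (1 : Matrix (Fin n) (Fin n) K))) p.1 p.2)) =
      Finset.univ.sup fun p : Fin n × Fin n => Valued.v (M p.1 p.2) := by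
  congr 1
  funext p
  rw [Matrix.mul_smul, Matrix.mul_one, Matrix.smul_apply, smul_eq_mul, map_mul, hu, one_mul]

/-- **The height of a diagonal matrix** is the largest diagonal entry: `h(diag(d)) = max_i |d_i|`. [cite: BruhatTits1972, (4.4.3)] [cite: Macdonald1971, Ch. V §2] -/
theorem sup_v_diagonal (d : Fin n → K) :
    (Finset.univ.sup fun p : Fin n × Fin n => Valued.v (Matrix.diagonal d p.1 p.2)) = Finset.univ.sup fun i => Valued.v (d i) := by
  refine le_antisymm ?_ ?_
  · rw [Finset.sup_le_iff]
    rintro ⟨i, j⟩ -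
    by_cases hij : i = j
    · subst hij
      rw [Matrix.diagonal_apply_eq]
      exact Finset.le_sup (f := fun i => Valued.v (d i)) (Finset.mem_univ i)
    · rw [Matrix.diagonal_apply_ne _ hij, map_zero]
      exact zero_le
  · rw [Finset.sup_le_iff]
    intro i _
    have := v_apply_le_sup (Matrix.diagonal d) i i
    rwa [Matrix.diagonal_apply_eq] at this

end Generic

/-! ## §2 `GL_n(𝒪)`-bi-invariance in the tree's `glInt` currency -/

section GLInt

variable {K : Type*} [Field K] [Valued K ℤᵐ⁰] [ValuativeRel K] [(Valued.v : Valuation K ℤᵐ⁰).Compatible] {n : ℕ}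

/-- `h(k M) = h(M)` for `k ∈ GL_n(𝒪) = glInt n K` (★ `mem_glInt_iff_forall_v_le_one`). [cite: BruhatTits1972, (4.4.3)] [cite: CartierCorvallis1979, §IV.1] -/
theorem sup_v_coe_mul_eq_of_mem_glInt {k : GL (Fin n) K} (hk : k ∈ glInt n K) (M : Matrix (Fin n) (Fin n) K) :
    (Finset.univ.sup fun p : Fin n × Fin n => Valued.v (((k : Matrix (Fin n) (Fin n) K) * M) p.1 p.2)) =
      Finset.univ.sup fun p : Fin n × Fin n => Valued.v (M p.1 p.2) :=
  sup_v_coe_mul_eq k ((mem_glInt_iff_forall_v_le_one k).1 hk).1 ((mem_glInt_iff_forall_v_le_one k).1 hk).2 M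

/-- `h(M k) = h(M)` for `k ∈ GL_n(𝒪) = glInt n K`. [cite: BruhatTits1972, (4.4.3)] [cite: CartierCorvallis1979, §IV.1] -/
theorem sup_v_mul_coe_eq_of_mem_glInt {k : GL (Fin n) K} (hk : k ∈ glInt n K) (M : Matrix (Fin n) (Fin n) K) :
    (Finset.univ.sup fun p : Fin n × Fin n => Valued.v ((M * (k : Matrix (Fin n) (Fin n) K)) p.1 p.2)) =
      Finset.univ.sup fun p : Fin n × Fin n => Valued.v (M p.1 p.2) :=
  sup_v_mul_coe_eq k ((mem_glInt_iff_forall_v_le_one k).1 hk).1 ((mem_glInt_iff_forall_v_le_one k).1 hk).2 M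

end GLInt

/-! ## §3 The unitary group `U(σ, Φ₃)(K)`: norm-one central scalars, the ray `d(ϖ, 1, (σϖ)⁻¹)`, disjoint shells -/

section Unitary

variable {K : Type*} [Field K] [Valued K ℤᵐ⁰] [ValuativeRel K] [(Valued.v : Valuation K ℤᵐ⁰).Compatible]
  (σ : K →+* K) {J : Matrix (Fin 3) (Fin 3) K} (hJ : J = (StdForm.antidiagonal 3).over K)

omit [ValuativeRel K] [(Valued.v : Valuation K ℤᵐ⁰).Compatible] in
include hJ in
/-- **A scalar `u · 1 ∈ U(σ, Φ₃)` has `|u| = 1`**: the unitary relation reads `σ(u) u · Φ₃ = Φ₃`, so `σ(u) u = 1`, and `|σ u| = |u|`.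
[cite: PlatonovRapinchuk1994, §2.3] [cite: Rogawski1990, §1.9 p. 8] -/
theorem v_eq_one_of_coe_eq_scalar (hσv : ∀ x, Valued.v (σ x) = Valued.v x) {z : ↥(unitaryGroupOfForm σ J)} {u : Kˣ}
    (hz : ((z : ↥(unitaryGroupOfForm σ J)) : GL (Fin 3) K) = Matrix.GeneralLinearGroup.scalar (Fin 3) u) :
    Valued.v (u : K) = 1 := by
  subst hJ
  have hmem := mem_unitaryGroupOfForm_iff.1 z.2
  rw [hz, Matrix.GeneralLinearGroup.coe_scalar, Matrix.scalar_apply, Matrix.diagonal_map (map_zero σ),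
    Matrix.diagonal_transpose] at hmem
  -- read the `(0, 2)` entry: `σ(u) · 1 · u = 1`
  have h02 := congrArg (fun A : Matrix (Fin 3) (Fin 3) K => A 0 2) hmem
  simp only [Matrix.mul_diagonal, Matrix.diagonal_mul] at h02
  have hJ02 : ((StdForm.antidiagonal 3).over K) 0 2 = 1 := by
    simp [StdForm.over, StdForm.antidiagonal]
  rw [hJ02, mul_one] at h02
  -- `|σ u| |u| = 1` with `|σ u| = |u|`
  have hv : Valued.v (u : K) * Valued.v (u : K) = 1 := by
    have := congrArg Valued.v h02
    rwa [map_mul, map_one, hσv] at this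
  rcases lt_trichotomy (Valued.v (u : K)) 1 with hlt | heq | hgt
  · exact absurd hv (mul_lt_one_of_nonneg_of_lt_one_left zero_le hlt hlt.le).ne
  · exact heq
  · exact absurd hv (one_lt_mul_of_lt_of_le' hgt hgt.le).ne'

omit [ValuativeRel K] [(Valued.v : Valuation K ℤᵐ⁰).Compatible] in
include hJ in
/-- **`Z(U)`-invariance of the height**: for `z ∈ Z(U(σ, Φ₃))` (a scalar `u · 1` with `|u| = 1`, ★ `exists_coe_eq_scalar_of_mem_center_unitaryGroupOfForm`)
and every `g`, `h(g z) = h(g)`. [cite: PlatonovRapinchuk1994, §2.3] [cite: CartierCorvallis1979, §IV.1] -/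
theorem sup_v_mul_coe_eq_of_mem_center (hσσ : ∀ x, σ (σ x) = x) (hσv : ∀ x, Valued.v (σ x) = Valued.v x) (h2 : (2 : K) ≠ 0)
    (h3 : (3 : K) ≠ 0) {z : ↥(unitaryGroupOfForm σ J)} (hz : z ∈ Subgroup.center ↥(unitaryGroupOfForm σ J))
    (g : ↥(unitaryGroupOfForm σ J)) :
    (Finset.univ.sup fun p : Fin 3 × Fin 3 => Valued.v ((((g * z : ↥(unitaryGroupOfForm σ J)) : GL (Fin 3) K) : Matrix (Fin 3) (Fin 3) K) p.1 p.2)) =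
      Finset.univ.sup fun p : Fin 3 × Fin 3 => Valued.v ((((g : ↥(unitaryGroupOfForm σ J)) : GL (Fin 3) K) : Matrix (Fin 3) (Fin 3) K) p.1 p.2) := by
  have hH : (J.map σ)ᵀ = J := by rw [hJ, StdForm.over_map, StdForm.transpose_over]
  have hHd : J.det ≠ 0 := by
    rw [hJ]
    exact ((Matrix.isUnit_iff_isUnit_det _).1 ((StdForm.antidiagonal 3).isUnit_over K)).ne_zero
  obtain ⟨u, hu⟩ := UnitaryGroup.exists_coe_eq_scalar_of_mem_center_unitaryGroupOfForm σ J hσσ hH hHd h2 h3 hz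
  have hv := v_eq_one_of_coe_eq_scalar σ hJ hσv hu
  rw [Subgroup.coe_mul, Units.val_mul, hu, Matrix.GeneralLinearGroup.coe_scalar, Matrix.scalar_apply, ← Matrix.smul_one_eq_diagonal]
  exact sup_v_mul_smul_one_eq hv _

omit [ValuativeRel K] [(Valued.v : Valuation K ℤᵐ⁰).Compatible] in
/-- **The height along the ray**: for `a = d(ϖ, 1, (σϖ)⁻¹)` with `0 < |ϖ| < 1` and `|σ ϖ| = |ϖ|`, `h(aᵐ) = |ϖ|⁻ᵐ` (★ `coe_pow_eq_diagonal`: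
`aᵐ = d(ϖᵐ, 1, (σϖ)⁻ᵐ)`, and `|ϖ|ᵐ ≤ 1 ≤ |ϖ|⁻ᵐ`). [cite: BruhatTits1972, (4.4.3)] [cite: Rogawski1990, §1.10 p. 9] -/
theorem sup_v_coe_pow_eq (hσv : ∀ x, Valued.v (σ x) = Valued.v x) {ϖ : K} (hϖ0 : ϖ ≠ 0) (hϖ1 : Valued.v ϖ < 1)
    (a : ↥(unitaryGroupOfForm σ J)) (ha : ((a : GL (Fin 3) K) : Matrix (Fin 3) (Fin 3) K) = Matrix.diagonal ![ϖ, 1, (σ ϖ)⁻¹]) (m : ℕ) :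
    (Finset.univ.sup fun p : Fin 3 × Fin 3 =>
        Valued.v ((((a ^ m : ↥(unitaryGroupOfForm σ J)) : GL (Fin 3) K) : Matrix (Fin 3) (Fin 3) K) p.1 p.2)) =
      (Valued.v ϖ)⁻¹ ^ m := by
  rw [UnitaryGroup.coe_pow_eq_diagonal σ a ha m, sup_v_diagonal]
  have hv0 : Valued.v ϖ ≠ 0 := (Valuation.ne_zero_iff _).2 hϖ0
  have h1 : (1 : ℤᵐ⁰) ≤ (Valued.v ϖ)⁻¹ := (one_le_inv₀ (zero_lt_iff.2 hv0)).2 hϖ1.le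
  have hle : Valued.v ϖ ^ m ≤ (Valued.v ϖ)⁻¹ ^ m := pow_le_pow_left₀ zero_le (hϖ1.le.trans h1) m
  refine le_antisymm ?_ ?_
  · rw [Finset.sup_le_iff]
    intro i _
    fin_cases i
    · simpa using hle
    · simpa using one_le_pow₀ h1
    · simp [map_inv₀, hσv]
  · have := Finset.le_sup (f := fun i : Fin 3 => Valued.v ((![ϖ ^ m, 1, (σ ϖ)⁻¹ ^ m] : Fin 3 → K) i)) (Finset.mem_univ (2 : Fin 3))
    simpa [map_inv₀, hσv] using this

include hJ in
/-- **The Cartan shells of `U(σ, Φ₃)(K)` are pairwise disjoint modulo the centre.**  For `σ` an involution with `|σ x| = |x|`, `2, 3 ≠ 0` in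
`K`, the ray `a = d(ϖ, 1, (σϖ)⁻¹)` with `0 < |ϖ| < 1`, and ANY subgroup `K' ≤ K₀ = U ∩ GL₃(𝒪)`: the images of the double cosets `K' aᵐ K'`
(`m ∈ ℕ`) in `U ⧸ Z(U)` are pairwise disjoint — the height `h` is bi-`K'`-invariant (§2), `Z(U)`-invariant (`sup_v_mul_coe_eq_of_mem_center`)
and `h(aᵐ) = |ϖ|⁻ᵐ` separates the powers (★ `RayCoefficient.pairwise_disjoint_image_doubleCoset_of_height`).  This is the `hdisj` input of the
⇒ half of Casselman's criterion (★ `RayCoefficient.norm_sq_mul_lt_one`) at every level `K' = K_γ ∩ U`.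
[cite: BruhatTits1972, (4.4.3)] [cite: CartierCorvallis1979, §IV.1] [cite: Casselman1995, Thm. 4.4.6] -/
theorem pairwise_disjoint_image_doubleCoset_pow (hσσ : ∀ x, σ (σ x) = x) (hσv : ∀ x, Valued.v (σ x) = Valued.v x)
    (h2 : (2 : K) ≠ 0) (h3 : (3 : K) ≠ 0) {ϖ : K} (hϖ0 : ϖ ≠ 0) (hϖ1 : Valued.v ϖ < 1)
    (a : ↥(unitaryGroupOfForm σ J)) (ha : ((a : GL (Fin 3) K) : Matrix (Fin 3) (Fin 3) K) = Matrix.diagonal ![ϖ, 1, (σ ϖ)⁻¹])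
    (K' : Subgroup ↥(unitaryGroupOfForm σ J)) (hK' : K' ≤ (glInt 3 K).comap (unitaryGroupOfForm σ J).subtype) :
    Pairwise (Function.onFun Disjoint fun m : ℕ =>
      (QuotientGroup.mk : ↥(unitaryGroupOfForm σ J) → ↥(unitaryGroupOfForm σ J) ⧸ Subgroup.center ↥(unitaryGroupOfForm σ J)) ''
        DoubleCoset.doubleCoset (a ^ m) (K' : Set ↥(unitaryGroupOfForm σ J)) K') := by
  refine RayCoefficient.pairwise_disjoint_image_doubleCoset_of_height
    (fun g : ↥(unitaryGroupOfForm σ J) => Finset.univ.sup fun p : Fin 3 × Fin 3 =>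
      Valued.v ((((g : ↥(unitaryGroupOfForm σ J)) : GL (Fin 3) K) : Matrix (Fin 3) (Fin 3) K) p.1 p.2))
    (fun κ₁ hκ₁ κ₂ hκ₂ g => ?_) (fun z hz g => sup_v_mul_coe_eq_of_mem_center σ hJ hσσ hσv h2 h3 hz g) (fun m₁ m₂ hm => ?_)
  · change (Finset.univ.sup fun p : Fin 3 × Fin 3 =>
        Valued.v ((((κ₁ * g * κ₂ : ↥(unitaryGroupOfForm σ J)) : GL (Fin 3) K) : Matrix (Fin 3) (Fin 3) K) p.1 p.2)) = _
    have hκ₁' : ((κ₁ : ↥(unitaryGroupOfForm σ J)) : GL (Fin 3) K) ∈ glInt 3 K := hK' hκ₁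
    have hκ₂' : ((κ₂ : ↥(unitaryGroupOfForm σ J)) : GL (Fin 3) K) ∈ glInt 3 K := hK' hκ₂
    rw [Subgroup.coe_mul, Subgroup.coe_mul, Units.val_mul, Units.val_mul, sup_v_mul_coe_eq_of_mem_glInt hκ₂',
      sup_v_coe_mul_eq_of_mem_glInt hκ₁']
  · have hv0 : Valued.v ϖ ≠ 0 := (Valuation.ne_zero_iff _).2 hϖ0
    have h1 : (1 : ℤᵐ⁰) < (Valued.v ϖ)⁻¹ := (one_lt_inv₀ (zero_lt_iff.2 hv0)).2 hϖ1
    have hm' : (Valued.v ϖ)⁻¹ ^ m₁ = (Valued.v ϖ)⁻¹ ^ m₂ := by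
      have := hm
      simp only [sup_v_coe_pow_eq σ hσv hϖ0 hϖ1 a ha] at this
      exact this
    exact (pow_right_strictMono₀ h1).injective hm'

end Unitary

end Literature.NumberTheory.Automorphic.EntryHeight
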